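import Summits.ValiantsHypothesis.ValiantsHypothesis.Theses.UnpaddedGIT
import Summits.ValiantsHypothesis.ValiantsHypothesis.Theorems.HubHub
import Literature.Computability.AlgebraicComplexity.VPDeterminantalQPProofs
import Literature.Computability.AlgebraicComplexity.DeterminantalComplexityProofs
import Literature.Computability.AlgebraicComplexity.ValiantConjectureProofs

/-!
# Route UnpaddedGIT — item `Assembly`

Item `stmt-ValiantsHypothesis-5766` (assembly of route `UnpaddedGIT`): the route target
`InvariantSeparationQP` (for every `c`, eventually in `n`, for every `m ≤ 2^((log₂ n + c)^c)` some
`SL_{n²}`-invariant polynomial on degree-`n` forms vanishes on the pencil-coefficient family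
`D_m(n)` and not at `per_n`) implies `ValiantsHypothesis` (`VP ℂ ≠ VNP ℂ`). Pure bookkeeping, with
the tree's PROVED facts used (not assumed):
* `VP` families have quasi-polynomially bounded determinantal complexity
  (`Literature.Computability.AlgebraicComplexity.isQPBounded_determinantalComplexity_of_isVPFamily_holds`;
  Bürgisser–Clausen–Shokrollahi 1997, Cor. (21.40));
* `dc` is attained (`hasDetRepr_determinantalComplexity_holds`; Mignon–Ressayre 2004 §1);
* `per_n` is homogeneous of degree `n` (`perPoly_isHomogeneous`), so `hc_n (det A) = per_n` when
  `det A = per_n`;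
* the renaming bridge `mem_VP_ofFintype_iff_holds` and Valiant's `perFamily_mem_VNP_holds`, fed to
  the hub lemma `Summit.ValiantsHypothesis.Hub.valiantsHypothesis_of_not_isVPFamily_per`
  (Theorems/HubHub.lean).

Proof: were `per` a `VP` family, `dc(per_n) ≤ 2^((log₂ n + c)^c)` for one `c` and all `n`; take
`n₀` from the target at this `c`, `n := n₀`, `m := dc(per_n₀)`; an affine `A` of size `m` with
`det A = per_n₀` gives `hc_n₀ (det A) = per_n₀ ∈ D_m(n₀)`, so the separating invariant `F` has
`F(per_n₀) = 0`, contradicting `F(per_n₀) ≠ 0`.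
-/

-- single-conjunct layout: Sub = Summit, duplicated namespace component intended
set_option linter.dupNamespace false

namespace Summit.ValiantsHypothesis.ValiantsHypothesis.Theorems

open MvPolynomial Literature.Computability.AlgebraicComplexity

/-- The permanent family over `ℂ` is not a `VP` family if the route target
`InvariantSeparationQP` holds: a `VP` permanent has `dc(per_n)` quasi-polynomially bounded
(BCS 1997 Cor. (21.40), tree theorem), the bound is attained by an affine matrix `A` with
`det A = per_n`, and `hc_n (det A) = per_n` lies in the pencil-coefficient family on which the
separating invariant vanishes — while it does not vanish at `per_n`. [folklore] -/
theorem not_isVPFamily_per_of_invariantSeparationQP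
    (hX : Theses.UnpaddedGIT.InvariantSeparationQP) :
    ¬ IsVPFamily (fun n => perPoly (Fin n) ℂ) := by
  intro hVP
  -- `dc(per_n)` is quasi-polynomially bounded with some constant `c`
  obtain ⟨c, hc⟩ :=
    isQPBounded_determinantalComplexity_of_isVPFamily_holds (fun n => perPoly (Fin n) ℂ) hVP
  -- the target at this `c`
  obtain ⟨n₀, hn₀⟩ := hX c
  obtain ⟨F, -, hvan, hper⟩ :=
    hn₀ n₀ le_rfl (determinantalComplexity (perPoly (Fin n₀) ℂ)) (hc n₀)
  -- an affine determinantal representation of size exactly `dc(per_n₀)`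
  obtain ⟨A, hA, hdet⟩ := hasDetRepr_determinantalComplexity_holds (perPoly (Fin n₀) ℂ)
  -- `per_n₀` is homogeneous of degree `n₀`, so `hc_n₀ (det A) = per_n₀`
  have hhom : (perPoly (Fin n₀) ℂ).IsHomogeneous n₀ := by
    simpa using perPoly_isHomogeneous (n := Fin n₀) (k := ℂ)
  have h0 := hvan A hA
  rw [hdet, homogeneousComponent_eq_self hhom] at h0
  exact hper h0

/-- **Assembly** (route UnpaddedGIT, item `stmt-ValiantsHypothesis-5766`):
`InvariantSeparationQP → ValiantsHypothesis`. Bookkeeping: by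
`not_isVPFamily_per_of_invariantSeparationQP` the permanent family over `ℂ` is not a `VP` family;
the hub lemma `Summit.ValiantsHypothesis.Hub.valiantsHypothesis_of_not_isVPFamily_per` with the
renaming bridge (`mem_VP_ofFintype_iff_holds`) and Valiant's `per ∈ VNP`
(`perFamily_mem_VNP_holds`) gives `VP ℂ ≠ VNP ℂ`. [folklore] -/
theorem unpaddedGIT_assembly_proof : Theses.UnpaddedGIT.Assembly := by
  unfold Theses.UnpaddedGIT.Assembly
  intro hX
  exact Summit.ValiantsHypothesis.Hub.valiantsHypothesis_of_not_isVPFamily_per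
    (not_isVPFamily_per_of_invariantSeparationQP hX)
    (mem_VP_ofFintype_iff_holds (k := ℂ) (fun n => perPoly (Fin n) ℂ))
    (perFamily_mem_VNP_holds ℂ)

end Summit.ValiantsHypothesis.ValiantsHypothesis.Theorems
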